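import Summits.QuantumFields.YangMills.Theorems.UnitScaleTiltProp7HcoWOfGaugedRows
import HarnessLib

/-!
# Route `UnitScaleTilt`, crux K1 «MinimiserStabilityRegPr» (stmt-QuantumFields-19200) — `hcoS` ((141)–(142) ON Σ-REPRESENTATIVES, the growth socket after namer LOCATE v3 «GAUGE HOLE»)
# FROM THE GAUGED ROWS: the Σ-twin of ★w4 g5's ✓`Prop7HcoWOfGaugedRows.hcoW_of_gaugedRowsW`

Cell `ym3-torus` ∕ fleet seat `ym-ust-19200-p1` (gen 17, route-R E′ lead ∕ namer).  THEOREMS ONLY (0 `def`, 0 `sorry`); `--supports stmt-QuantumFields-19200`, count-neutral.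
YM₃ on T³ is a ladder rung (R3), not the Clay problem; nothing here claims the stub, the crux, `hcoW`, `hcoS`, d = 4 or the mass gap — every row is DISPLAYED.

WHY (LOCATE v3, HOME `ym-ust-19200-p1/LOCATE-GAUGE-HOLE-p1g17.md`).  The rows {CHART `s`, HESS `κ·M ≤ K`, JOINT mod coarse gauge} of ✓`hcoW_of_gaugedRowsW` are stated over `hcoW`’s
binder, which lacks the axial clause tying the gauge transformation `u` to the frames of `ηA` and therefore admits gauge-heavy data on which HESS in the chart-mass currency is
false; ✓`Prop7HcoWOfHcoSigma.hcoW_of_hcoSigma` reduces `hcoW` to `hcoS` = (141)–(142) on Σ-representatives `X` ((19) `In19`, (20) `AvgCondPrint`, (21) `IsLandauPrint`; no `u`),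
where print works ([Balaban1985Variational] p.281, p.299 «B = 0»).  This file is the growth door in those letters: SAME three inner theorems as ★w4’s (the gauged weak-E–L pairing
✓`abs_lin_le_sum_norm_trueLinIter_weakEL_sub_coarseGauge`, ✓`Prop7LocMinOfJointRow.linRow_of_QRows`, the Taylor door ✓`wilsonAction4_le_expChart_of_linRow`), binder = `hcoS`’s.

WHAT IS PROVED (ns `…Theorems.Prop7HcoSOfGaugedRows`): ★★★ `hcoS_of_gaugedRowsS` — HYPOTHESIS `hQS`: for every Σ-datum `(W, X)` of the `hcoS` binder there are `s κ C₁ C₂` with CHART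
`‖X b‖ ≤ s`, `4s ≤ 1`; HESS `κ·Σ_b‖X b‖² ≤ Σ_p‖ℒ_p(X)‖²`; JOINT modulo an `𝔰𝔲(2)`-valued coarse site field (VERBATIM letters of ✓`hcoW_of_gaugedRowsW` with `ηA ↦ X`); windows
`2eC₂ ≤ ⅛`, `2eC₁ℓ⁻² + 15552s² + 216·regThreshold(e) ≤ κ∕8`.  CONCLUSION = `hcoS` VERBATIM (the hypothesis of ✓`hcoW_of_hcoSigma`).
HONEST SCOPE.  Bookkeeping over landed theorems; CHART∕HESS∕JOINT on Σ remain DISPLAYED (on Σ: `μ := r(X)` by ✓P-A1 LEG, HESS from [B9] Thm 3.11 on print’s slice).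

References: T. Bałaban, CMP 102 (1985) 277–309 [Balaban1985Variational] ((19)–(21) p.281, (47)–(49) pp.285–286, (112) p.294, (141)–(143) p.299); CMP 99 (1985) 389–434
[Balaban1985BackgroundPropagators] ((3.9)–(3.11) p.392); CMP 98 (1985) 17–51 [Balaban1985Averaging] ((84)–(92) p.31).
-/

set_option autoImplicit false
noncomputable section

open scoped BigOperators Matrix.Norms.L2Operator Matrix Topology
open Filter NormedSpace

open Literature.MathematicalPhysics.QuantumFieldTheory.Balaban1983to89
open Literature.MathematicalPhysics.QuantumFieldTheory.Balaban1983to89.T3ContinuumYM3Torus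
open Literature.MathematicalPhysics.QuantumFieldTheory.Balaban1983to89.T3UnitLawDensityEML (ℰp)
open Literature.MathematicalPhysics.QuantumFieldTheory.Balaban1983to89.T3ConstrainedMinimiser (fibre)
open Literature.MathematicalPhysics.QuantumFieldTheory.Balaban1983to89.T3PrintedRegularMinimiser
open Literature.MathematicalPhysics.QuantumFieldTheory.Balaban1983to89.T3RegularMinimiser
open Literature.MathematicalPhysics.QuantumFieldTheory.Balaban1983to89.T3Thm1Carrier
open T4Continuum BlockAveraging AveragingRT ExpMeanLog BlockAveragingEMLLinearised BlockAveragingEMLLinearisedBackground BlockAveragingEMLProp2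
open B10Eq27TorusAxialLog (pull)
open T3SectALandauChart (emb15 eta bgUnits pos_of_regPr)
open Summit.QuantumFields.YangMills.Theorems.Prop7SPrint (basePt RestrictedPrint)
open Summit.QuantumFields.YangMills.Theorems.Prop7TPrint (expHerm expHermField expHermField_apply coe_expHerm)
open Summit.QuantumFields.YangMills.Theorems.Prop7SPrintIn19 (trace_eq_zero_of_exp_mem_SU2)
open Summit.QuantumFields.YangMills.Theorems.Prop7LocMinOfJointRow (wilsonAction4_le_expChart_of_linRow linRow_of_QRows)
open Summit.QuantumFields.YangMills.Theorems.Prop7CurvedLandauRowA (exists_trueLinIter_family)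
open Summit.QuantumFields.YangMills.Theorems.Prop7FirstVariationWeakEL (weakEL_of_fibreEL)
open Summit.QuantumFields.YangMills.Theorems.Prop7FirstVariationMultiplierBoundWeakEL (abs_lin_le_sum_norm_trueLinIter_weakEL)
open Summit.QuantumFields.YangMills.Theorems.Prop7FirstVariationExactPairing (tower_loop_rows_of_regPr gaugeDir_mem_su2)
open Summit.QuantumFields.YangMills.Theorems.Prop7TrueLinPureGaugeIter (trueLinIter_sub trueLinIter_pureGauge)
open Summit.QuantumFields.YangMills.Theorems.Prop7LinGaugeInvariance (lin_sub_gaugeDir_eq)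
open Summit.QuantumFields.YangMills.Theorems.Prop7LocMinOfGaugedRows (sub_gaugeDir_mem_su2)
open B15DeterminingSets (embIter)
open B5Eq118OneStroke (iterBlockOf)
open Node00 (iterBlockOf_embIter_eq)
open Summit.QuantumFields.YangMills.Theorems.Prop7HcoWOfGaugedRows (abs_lin_le_sum_norm_trueLinIter_weakEL_sub_coarseGauge)
open Summit.QuantumFields.YangMills.Theorems.Prop7SPrint (AvgCondPrint IsLandauPrint)
open T3SectALandauChart (In19)

namespace Summit.QuantumFields.YangMills.Theorems.Prop7HcoSOfGaugedRows

set_option maxHeartbeats 400000 in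
/-- ★★★ **`hcoS` ((141)–(142) ON Σ) FROM CHART ∧ HESS ∧ THE JOINT REMAINDER ROW MODULO COARSE GAUGE, AT THE E–L-CRITICAL BACKGROUND** — the Σ-twin of ✓`hcoW_of_gaugedRowsW`
(rows VERBATIM with `ηA ↦ X`; binder = `hcoS`’s: `In19 ∕ AvgCondPrint ∕ IsLandauPrint`, no gauge transformation).  Proof = ★w4 g5’s, over the same three inner theorems.
[cite: Balaban1985Variational, (141)-(143) p.299, (19)-(21) p.281, (116) p.295, (47)-(49) pp.285-286, (112) p.294; Balaban1985BackgroundPropagators, (3.11) p.392] -/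
theorem hcoS_of_gaugedRowsS
    (hQS : ∀ (L : ℕ), 1 < L → ∀ (B₁' : ℝ), 0 < B₁' → ∃ e₇ : ℝ, 0 < e₇ ∧
      ∀ (F : T3Family), F.L = L → ∀ (n K : ℕ) (hnK : n < K) (e : ℝ) (V : GaugeField (F.P n) 0 (Matrix.specialUnitaryGroup (Fin 2) ℂ))
        (W : GaugeField (F.P K) 0 (Matrix.specialUnitaryGroup (Fin 2) ℂ)) (X : PBond (F.P K) 0 → Matrix (Fin 2) (Fin 2) ℂ),
        0 < e → e ≤ e₇ → W ∈ regFibrePr F n K hnK.le e V →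
        (∀ γ : ℝ → GaugeField (F.P K) 0 (Matrix.specialUnitaryGroup (Fin 2) ℂ), γ 0 = W → (∀ t, γ t ∈ fibre F ℰp n K hnK.le V) →
          (∀ b, DifferentiableAt ℝ (fun t => ((γ t b : Matrix.specialUnitaryGroup (Fin 2) ℂ) : Matrix (Fin 2) (Fin 2) ℂ)) 0) →
            deriv (fun t => wilsonAction4 (γ t)) 0 = 0) →
        In19 F n K (2 * B₁' * e) W (expHermField X) X → AvgCondPrint F n K hnK.le V W X → IsLandauPrint F n K W X →
          ∃ s κ C₁ C₂ : ℝ, (∀ b : PBond (F.P K) 0, ‖X b‖ ≤ s) ∧ 4 * s ≤ 1 ∧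
            κ * ∑ b : PBond (F.P K) 0, ‖X b‖ ^ 2 ≤ ∑ p : Plaq (F.P K) 0, ‖((Complex.I • X ⟨p.src, p.μ⟩) + ((W ⟨p.src, p.μ⟩ : Matrix (Fin 2) (Fin 2) ℂ) * (Complex.I • X ⟨p.src.shift p.μ, p.ν⟩) * star (W ⟨p.src, p.μ⟩ : Matrix (Fin 2) (Fin 2) ℂ))
            - (((W ⟨p.src, p.μ⟩ * W ⟨p.src.shift p.μ, p.ν⟩ * (W ⟨p.src.shift p.ν, p.μ⟩)⁻¹ : Matrix.specialUnitaryGroup (Fin 2) ℂ) : Matrix (Fin 2) (Fin 2) ℂ) * (Complex.I • X ⟨p.src.shift p.ν, p.μ⟩) * star ((W ⟨p.src, p.μ⟩ * W ⟨p.src.shift p.μ, p.ν⟩ * (W ⟨p.src.shift p.ν, p.μ⟩)⁻¹ : Matrix.specialUnitaryGroup (Fin 2) ℂ) : Matrix (Fin 2) (Fin 2) ℂ))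
            - (((GaugeField.plaqHol W p : Matrix.specialUnitaryGroup (Fin 2) ℂ) : Matrix (Fin 2) (Fin 2) ℂ) * (Complex.I • X ⟨p.src, p.ν⟩) * star ((GaugeField.plaqHol W p : Matrix.specialUnitaryGroup (Fin 2) ℂ) : Matrix (Fin 2) (Fin 2) ℂ)))‖ ^ 2 ∧
            (∀ (Q : (k : ℕ) → (PBond (F.P K) 0 → Matrix (Fin 2) (Fin 2) ℂ) → PBond (F.P K) k → Matrix (Fin 2) (Fin 2) ℂ), (∀ Y, Q 0 Y = Y) →
        (∀ (k : ℕ) (Y : PBond (F.P K) 0 → Matrix (Fin 2) (Fin 2) ℂ) (c : PBond (F.P K) (k + 1)), Q (k + 1) Y c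
          = fderiv ℂ (eml : (Idx (F.P K) → Matrix (Fin 2) (Fin 2) ℂ) → Matrix (Fin 2) (Fin 2) ℂ)
              (fun i => ((loopHol (Averaging.iter (fun i => blockAvg (P := F.P K) (j := i) (expMeanLogSU (n := Fin 2))) k W) c i :
                Matrix.specialUnitaryGroup (Fin 2) ℂ) : Matrix (Fin 2) (Fin 2) ℂ))
              (fun i => covWalkSum (Averaging.iter (fun i => blockAvg (P := F.P K) (j := i) (expMeanLogSU (n := Fin 2))) k W) (Q k Y)
                  (walk (emb c.src) (loopWord (F.P K).L c.dir (off i.1) i.2.1 i.2.2))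
                * ((loopHol (Averaging.iter (fun i => blockAvg (P := F.P K) (j := i) (expMeanLogSU (n := Fin 2))) k W) c i :
                  Matrix.specialUnitaryGroup (Fin 2) ℂ) : Matrix (Fin 2) (Fin 2) ℂ))
              * star ((corr (expMeanLogSU (n := Fin 2)) (Averaging.iter (fun i => blockAvg (P := F.P K) (j := i) (expMeanLogSU (n := Fin 2))) k W) c :
                  Matrix.specialUnitaryGroup (Fin 2) ℂ) : Matrix (Fin 2) (Fin 2) ℂ)
            + ((corr (expMeanLogSU (n := Fin 2)) (Averaging.iter (fun i => blockAvg (P := F.P K) (j := i) (expMeanLogSU (n := Fin 2))) k W) c :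
                  Matrix.specialUnitaryGroup (Fin 2) ℂ) : Matrix (Fin 2) (Fin 2) ℂ)
              * covWalkSum (Averaging.iter (fun i => blockAvg (P := F.P K) (j := i) (expMeanLogSU (n := Fin 2))) k W) (Q k Y)
                  (walk (emb c.src) (List.replicate (F.P K).L (c.dir, true)))
              * star ((corr (expMeanLogSU (n := Fin 2)) (Averaging.iter (fun i => blockAvg (P := F.P K) (j := i) (expMeanLogSU (n := Fin 2))) k W) c :
                  Matrix.specialUnitaryGroup (Fin 2) ℂ) : Matrix (Fin 2) (Fin 2) ℂ)) →
            ∃ μ : Site (F.P K) (K - n) → Matrix (Fin 2) (Fin 2) ℂ, (∀ y, μ y ∈ skewAdjoint (Matrix (Fin 2) (Fin 2) ℂ) ∧ (μ y).trace = 0) ∧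
            ∑ c : PBond (F.P K) (K - n), ‖Q (K - n) (fun b => Complex.I • X b) c
                - (μ c.src
                  - ((Averaging.iter (fun i => blockAvg (P := F.P K) (j := i) (expMeanLogSU (n := Fin 2))) (K - n) W c : Matrix.specialUnitaryGroup (Fin 2) ℂ) :
                      Matrix (Fin 2) (Fin 2) ℂ) * μ c.tgt
                    * star ((Averaging.iter (fun i => blockAvg (P := F.P K) (j := i) (expMeanLogSU (n := Fin 2))) (K - n) W c : Matrix.specialUnitaryGroup (Fin 2) ℂ) :
                      Matrix (Fin 2) (Fin 2) ℂ))‖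
              ≤ C₁ * ((F.L : ℝ) ^ (K - n))⁻¹ * ∑ b : PBond (F.P K) 0, ‖X b‖ ^ 2
                + C₂ * (F.L : ℝ) ^ (K - n) * ∑ p : Plaq (F.P K) 0, ‖((Complex.I • X ⟨p.src, p.μ⟩) + ((W ⟨p.src, p.μ⟩ : Matrix (Fin 2) (Fin 2) ℂ) * (Complex.I • X ⟨p.src.shift p.μ, p.ν⟩) * star (W ⟨p.src, p.μ⟩ : Matrix (Fin 2) (Fin 2) ℂ))
            - (((W ⟨p.src, p.μ⟩ * W ⟨p.src.shift p.μ, p.ν⟩ * (W ⟨p.src.shift p.ν, p.μ⟩)⁻¹ : Matrix.specialUnitaryGroup (Fin 2) ℂ) : Matrix (Fin 2) (Fin 2) ℂ) * (Complex.I • X ⟨p.src.shift p.ν, p.μ⟩) * star ((W ⟨p.src, p.μ⟩ * W ⟨p.src.shift p.μ, p.ν⟩ * (W ⟨p.src.shift p.ν, p.μ⟩)⁻¹ : Matrix.specialUnitaryGroup (Fin 2) ℂ) : Matrix (Fin 2) (Fin 2) ℂ))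
            - (((GaugeField.plaqHol W p : Matrix.specialUnitaryGroup (Fin 2) ℂ) : Matrix (Fin 2) (Fin 2) ℂ) * (Complex.I • X ⟨p.src, p.ν⟩) * star ((GaugeField.plaqHol W p : Matrix.specialUnitaryGroup (Fin 2) ℂ) : Matrix (Fin 2) (Fin 2) ℂ)))‖ ^ 2) ∧
            2 * e * C₂ ≤ 1 / 8 ∧
            2 * e * C₁ * (((F.L : ℝ) ^ (K - n)) ^ 2)⁻¹ + 15552 * s ^ 2 + 216 * regThreshold F n K e ≤ κ / 8) :
    ∀ (L : ℕ), 1 < L → ∀ (B₁' : ℝ), 0 < B₁' → ∃ e₇ : ℝ, 0 < e₇ ∧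
      ∀ (F : T3Family), F.L = L → ∀ (n K : ℕ) (hnK : n < K) (e : ℝ) (V : GaugeField (F.P n) 0 (Matrix.specialUnitaryGroup (Fin 2) ℂ))
        (W : GaugeField (F.P K) 0 (Matrix.specialUnitaryGroup (Fin 2) ℂ)) (X : PBond (F.P K) 0 → Matrix (Fin 2) (Fin 2) ℂ),
        0 < e → e ≤ e₇ → W ∈ regFibrePr F n K hnK.le e V →
        (∀ γ : ℝ → GaugeField (F.P K) 0 (Matrix.specialUnitaryGroup (Fin 2) ℂ), γ 0 = W → (∀ t, γ t ∈ fibre F ℰp n K hnK.le V) →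
          (∀ b, DifferentiableAt ℝ (fun t => ((γ t b : Matrix.specialUnitaryGroup (Fin 2) ℂ) : Matrix (Fin 2) (Fin 2) ℂ)) 0) →
            deriv (fun t => wilsonAction4 (γ t)) 0 = 0) →
        In19 F n K (2 * B₁' * e) W (expHermField X) X → AvgCondPrint F n K hnK.le V W X → IsLandauPrint F n K W X →
          wilsonAction4 W ≤ wilsonAction4 (emb15 W (expHermField X)) := by
  intro L hL B₁' hB₁'
  obtain ⟨e₇, he₇, H⟩ := hQS L hL B₁' hB₁'
  have hL0 : (0 : ℝ) < (L : ℝ) := by exact_mod_cast (show 0 < L by omega)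
  have hbig : (0 : ℝ) < 10 ^ 10 * (L : ℝ) ^ 6 := by positivity
  refine ⟨min e₇ (10 ^ 10 * (L : ℝ) ^ 6)⁻¹, lt_min he₇ (inv_pos.mpr hbig), ?_⟩
  intro F hF n K hnK e V W X he heε hWreg hEL h19 h20 h21
  have he₇ : e ≤ e₇ := heε.trans (min_le_left _ _)
  have heL : 10 ^ 10 * (F.L : ℝ) ^ 6 * e ≤ 1 := by
    rw [hF]
    have h1 : e ≤ (10 ^ 10 * (L : ℝ) ^ 6)⁻¹ := heε.trans (min_le_right _ _)
    calc 10 ^ 10 * (L : ℝ) ^ 6 * e ≤ 10 ^ 10 * (L : ℝ) ^ 6 * (10 ^ 10 * (L : ℝ) ^ 6)⁻¹ := mul_le_mul_of_nonneg_left h1 hbig.le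
      _ = 1 := mul_inv_cancel₀ hbig.ne'
  obtain ⟨s, κ, C₁, C₂, hDs, hs4, hq, hJ, hw₁, hw₂⟩ := H F hF n K hnK e V W X he he₇ hWreg hEL h19 h20 h21
  -- the Σ-representative `X` is Hermitian-traceless ((19)), so `I•X` is `𝔰𝔲(2)`-valued
  have hDh : ∀ b : PBond (F.P K) 0, (X b).IsHermitian ∧ Matrix.trace (X b) = 0 := h19.1
  obtain ⟨hWfib, hreg⟩ := (mem_regFibrePr_iff F).mp hWreg
  -- a recursion family of the true linearisations along `W`'s tower, and (141) in the `Q`-currency at the E–L-critical `W`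
  obtain ⟨Q, hQ0, hQs⟩ := exists_trueLinIter_family (N := 2) W
  obtain ⟨μ, hμ, hJμ⟩ := hJ Q hQ0 hQs
  -- (141) MODULO COARSE GAUGE at the E–L-critical `W`: the multiplier current is covariantly conserved (✓`abs_lin_le_sum_norm_trueLinIter_weakEL_sub_coarseGauge`)
  have hELQ := abs_lin_le_sum_norm_trueLinIter_weakEL_sub_coarseGauge F hnK.le hWfib (weakEL_of_fibreEL F hnK.le hEL) he heL hreg Q hQ0 hQs
    (fun b => Complex.I • X b)
    (fun b => by
      rw [skewAdjoint.mem_iff, star_smul, Complex.star_def, Complex.conj_I, Matrix.star_eq_conjTranspose, (hDh b).1.eq, neg_smul])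
    (fun b => by rw [Matrix.trace_smul, (hDh b).2, smul_zero])
    μ (fun y => (hμ y).1) (fun y => (hμ y).2)
  beta_reduce at hELQ
  have hlin := linRow_of_QRows F he.le W X hELQ hJμ hq hw₁ hw₂
  exact wilsonAction4_le_expChart_of_linRow F hreg X hDh hDs hs4 hlin

end Summit.QuantumFields.YangMills.Theorems.Prop7HcoSOfGaugedRows

end
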